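import Literature.Analysis.Complex.RiemannDomainHolomorphic
import Mathlib.Topology.Homotopy.Lifting
import Mathlib.Analysis.Convex.Contractible
import Mathlib.MeasureTheory.Measure.Haar.NormedSpace
import HarnessLib

/-!
# Riemann domains finite over an open set: sheets over balls, and polynomial growth from `L²` bounds

Layer `Literature/Analysis/Complex`. Let `proj : D → ℂ^ι` be a flat Riemann domain which is
*proper over* an open set `Ω ⊆ ℂ^ι` (compact subsets of `Ω` have compact preimage), as is the
Riemann domain of a covering of a smooth affine variety over the finite locus of an étale chart
(SGA 1 XII Thm. 5.1, proof, part 2). This file supplies the elementary covering-space and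
mean-value geometry by which Hörmander's `L²` interpolation (`HormanderInterpolation`) yields
holomorphic functions of POLYNOMIAL GROWTH on the sheets over `Ω` (Hörmander (1973), Thm. 4.4.4 ⇒
Thm. 7.6.x-type bounds; Serre, GAGA n° 19–20 for the algebraic use):

* `isCoveringMapOn_of_isCompact_preimage` — proper over `Ω` + local homeomorphism ⇒ `proj` is a
  finite covering map over `Ω` (Mathlib `IsClosedMap.isCoveringMapOn_of_isLocalHomeomorphOn` on
  the restriction);
* `exists_section_ball` — over a ball `B ⊆ Ω` through any point of the fibre there is a continuous
  section of `proj` (Mathlib's lifting criterion for simply connected spaces), along which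
  flat-holomorphic functions are holomorphic (`IsFlatHolomorphic.differentiableOn_comp_section`)
  and the volume of `D` is Lebesgue measure (`lintegral_image_section`);
* `norm_le_of_integral_ball` — the scaled mean-value inequality
  `|H(z)| ≤ C r^{-2n} ∫_{B(z,r)} |H|` on `ℂ^ι`;
* `IsFlatHolomorphic.norm_le_of_eLpNorm` — **growth from the `L²` bound**: for `h` flat-holomorphic
  in `L²(D, e^{-g∘proj} d vol)` and a ball `B̄(proj t, 2r) ⊆ Ω`, `r ≤ 1`,
  `|h(t)| ≤ C r^{-2n} (sup_{B̄(proj t, r)} e^{g/2}) ‖h‖_{L²(e^{-g∘proj})}`.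

Everything is proved; there are no named facts.

## References

* L. Hörmander, *An Introduction to Complex Analysis in Several Variables* (1973), Thm. 2.2.3
  (mean value), Thm. 4.4.4, §5.4. [HormanderSCV1973]
* J.-P. Serre, *Géométrie algébrique et géométrie analytique*, Ann. Inst. Fourier 6 (1956),
  n° 19 Lemme 8, n° 20. [SerreGAGA1956]

#harness_tags complex_analysis.several_variables, topology.covering_space, complex_geometry.riemann_existence
-/

noncomputable section

open scoped Manifold ContDiff Topology ComplexConjugate ENNReal NNReal
open Set Filter Function Complex Metric MeasureTheory

namespace Literature.Analysis.Complex

namespace RiemannDomain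

universe u

variable {ι : Type} [Fintype ι] {D : RiemannDomain.{u} ι}

/-! ### Proper over an open set ⇒ covering over it -/

omit [Fintype ι] in
/-- The fibres of a locally injective map with compact fibres are finite. [folklore] -/
theorem finite_fibre_of_isCompact {X Y : Type*} [TopologicalSpace X] [TopologicalSpace Y] {f : X → Y}
    (hf : IsLocallyInjective f) {y : Y} (hc : IsCompact (f ⁻¹' {y})) : (f ⁻¹' {y}).Finite := by
  classical
  choose U hUo hxU hUinj using hf
  obtain ⟨S, hST, hSfin, hTS⟩ := hc.elim_finite_subcover_image
    (fun x (_ : x ∈ f ⁻¹' {y}) => hUo x) (fun x hx => mem_iUnion₂.2 ⟨x, hx, hxU x⟩)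
  refine hSfin.subset fun x hx => ?_
  obtain ⟨x', hx'S, hxx'⟩ := mem_iUnion₂.1 (hTS hx)
  have hfx : f x = y := hx
  have hfx' : f x' = y := hST hx'S
  have : x = x' := hUinj x' hxx' (hxU x') (hfx.trans hfx'.symm)
  exact this ▸ hx'S

/-- **A Riemann domain proper over an open set `Ω` is a finite covering of `Ω`**: if compact
subsets of `Ω` have compact preimage under `proj`, then `proj` is a covering map over `Ω` with finite
fibres. [cite: HormanderSCV1973, §5.4] -/
theorem isCoveringMapOn_of_isCompact_preimage {Ω : Set (ι → ℂ)} (hΩ : IsOpen Ω)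
    (hK : ∀ K ⊆ Ω, IsCompact K → IsCompact (D.proj ⁻¹' K)) :
    IsCoveringMapOn D.proj Ω ∧ ∀ z ∈ Ω, (D.proj ⁻¹' {z}).Finite := by
  have hloc := D.isLocalHomeomorph
  have hfin : ∀ z ∈ Ω, (D.proj ⁻¹' {z}).Finite := fun z hz ↦
    finite_fibre_of_isCompact hloc.isLocallyInjective (hK {z} (singleton_subset_iff.2 hz) isCompact_singleton)
  refine ⟨?_, hfin⟩
  -- the restriction `proj⁻¹ Ω → Ω` is a proper local homeomorphism, hence a closed map
  have hΩ' : IsOpen (D.proj ⁻¹' Ω) := hΩ.preimage hloc.continuous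
  set f := Ω.restrictPreimage D.proj with hf
  have hfc : Continuous f := hloc.continuous.restrictPreimage
  haveI : LocallyCompactSpace Ω := hΩ.locallyCompactSpace
  haveI : LocallyCompactSpace (D.proj ⁻¹' Ω) := hΩ'.locallyCompactSpace
  have hfprop : IsProperMap f := by
    rw [isProperMap_iff_isCompact_preimage]
    refine ⟨hfc, fun K hKc ↦ ?_⟩
    have h1 : IsCompact (D.proj ⁻¹' (Subtype.val '' K)) :=
      hK _ (fun z ⟨w, _, hw⟩ ↦ hw ▸ w.2) (hKc.image continuous_subtype_val)
    rw [Subtype.isCompact_iff]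
    convert h1 using 1
    ext y
    simp only [mem_image, mem_preimage, Subtype.exists, exists_and_right, exists_eq_right, hf]
    constructor
    · rintro ⟨hy, hyK⟩
      exact ⟨(Ω.restrictPreimage D.proj ⟨y, hy⟩).2, by simpa using hyK⟩
    · rintro ⟨hz, hzK⟩
      exact ⟨hz, by simpa using hzK⟩
  have hfclosed : IsClosedMap f := hfprop.isClosedMap
  have hfloc : IsLocalHomeomorph f := by
    refine IsLocalHomeomorph.of_comp (g := (Subtype.val : Ω → ι → ℂ)) ?_
      hΩ.isOpenEmbedding_subtypeVal.isLocalHomeomorph hfc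
    have : (Subtype.val : Ω → ι → ℂ) ∘ f = D.proj ∘ (Subtype.val : D.proj ⁻¹' Ω → D) := by
      funext x; rfl
    rw [this]
    exact hloc.comp hΩ'.isOpenEmbedding_subtypeVal.isLocalHomeomorph
  have hffin : ∀ z : Ω, (f ⁻¹' {z}).Finite := fun z ↦ by
    have : f ⁻¹' {z} = Subtype.val ⁻¹' (D.proj ⁻¹' {(z : ι → ℂ)}) := by
      ext x
      simp only [mem_preimage, mem_singleton_iff, hf]
      exact ⟨fun h ↦ congrArg Subtype.val h, fun h ↦ Subtype.ext h⟩
    rw [this]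
    exact (hfin z z.2).preimage Subtype.val_injective.injOn
  have hcov : IsCoveringMap f :=
    isCoveringMap_iff_isCoveringMapOn_univ.2
      (hfclosed.isCoveringMapOn_of_isLocalHomeomorphOn (fun z _ ↦ hffin z) hfloc.isLocalHomeomorphOn)
  exact IsCoveringMapOn.of_isCoveringMap_restrictPreimage (f := D.proj) (s := Ω) hΩ hΩ' hcov

/-! ### Continuous sections: holomorphy and measure -/

/-- **A continuous local section of `proj` is locally a flat chart inverse**: if `s` is continuous
on the open `V` with `proj ∘ s = id` there, then near `z₀ ∈ V`, `s = (chart (s z₀))⁻¹`. [folklore] -/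
theorem section_eventuallyEq_symm {V : Set (ι → ℂ)} (hV : IsOpen V) {s : (ι → ℂ) → D} (hs : ContinuousOn s V)
    (hsec : ∀ z ∈ V, D.proj (s z) = z) {z₀ : ι → ℂ} (hz₀ : z₀ ∈ V) :
    s =ᶠ[𝓝 z₀] (D.chart (s z₀)).symm := by
  have h1 : ∀ᶠ z in 𝓝 z₀, s z ∈ (D.chart (s z₀)).source :=
    (hs.continuousAt (hV.mem_nhds hz₀)).preimage_mem_nhds
      ((D.chart (s z₀)).open_source.mem_nhds (D.mem_chart_source _))
  filter_upwards [h1, hV.mem_nhds hz₀] with z hz hzV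
  rw [← (D.chart (s z₀)).left_inv hz, D.coe_chart, hsec z hzV]

/-- **Flat-holomorphic functions are holomorphic along continuous sections.** [folklore] -/
theorem IsFlatHolomorphic.differentiableOn_comp_section {h : D → ℂ} (hh : IsFlatHolomorphic D h)
    {V : Set (ι → ℂ)} (hV : IsOpen V) {s : (ι → ℂ) → D} (hs : ContinuousOn s V)
    (hsec : ∀ z ∈ V, D.proj (s z) = z) : DifferentiableOn ℂ (h ∘ s) V := by
  intro z₀ hz₀
  have heq : h ∘ s =ᶠ[𝓝 z₀] h ∘ (D.chart (s z₀)).symm :=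
    (section_eventuallyEq_symm hV hs hsec hz₀).fun_comp h
  have hd : DifferentiableAt ℂ (h ∘ (D.chart (s z₀)).symm) z₀ := by
    have := hh.differentiableAt (s z₀)
    rwa [hsec z₀ hz₀] at this
  exact (hd.congr_of_eventuallyEq heq).differentiableWithinAt

/-- The image of an open set under a continuous section of `proj` is open. [folklore] -/
theorem isOpen_image_section {V : Set (ι → ℂ)} (hV : IsOpen V) {s : (ι → ℂ) → D} (hs : ContinuousOn s V)
    (hsec : ∀ z ∈ V, D.proj (s z) = z) : IsOpen (s '' V) := by
  rw [isOpen_iff_mem_nhds]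
  rintro _ ⟨z₀, hz₀, rfl⟩
  -- near `z₀`, `s = chart⁻¹`; so `chart.source ∩ proj⁻¹ W ⊆ s(V)` for a small `W ∋ z₀`
  obtain ⟨W, hWsub, hWopen, hz₀W⟩ := _root_.eventually_nhds_iff.1
    ((section_eventuallyEq_symm hV hs hsec hz₀).and (hV.mem_nhds hz₀))
  have hsub : (D.chart (s z₀)).source ∩ D.proj ⁻¹' W ⊆ s '' V := by
    rintro y ⟨hy, hyW⟩
    obtain ⟨heq, hyV⟩ := hWsub (D.proj y) hyW
    refine ⟨D.proj y, hyV, ?_⟩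
    rw [heq, ← D.coe_chart (s z₀), (D.chart (s z₀)).left_inv hy]
  refine mem_of_superset (((D.chart (s z₀)).open_source.inter (hWopen.preimage D.isLocalHomeomorph.continuous)).mem_nhds
    ⟨D.mem_chart_source _, ?_⟩) hsub
  rw [mem_preimage, hsec z₀ hz₀]; exact hz₀W

/-- **The partial homeomorphism of a continuous section**: `proj` restricted to `s(V)`, with
inverse `s`. [folklore] -/
def sectionHomeomorph {V : Set (ι → ℂ)} (hV : IsOpen V) {s : (ι → ℂ) → D} (hs : ContinuousOn s V)
    (hsec : ∀ z ∈ V, D.proj (s z) = z) : OpenPartialHomeomorph D (ι → ℂ) where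
  toFun := D.proj
  invFun := s
  source := s '' V
  target := V
  map_source' := by rintro _ ⟨z, hz, rfl⟩; rw [hsec z hz]; exact hz
  map_target' := fun z hz ↦ ⟨z, hz, rfl⟩
  left_inv' := by rintro _ ⟨z, hz, rfl⟩; rw [hsec z hz]
  right_inv' := fun z hz ↦ hsec z hz
  open_source := isOpen_image_section hV hs hsec
  open_target := hV
  continuousOn_toFun := D.isLocalHomeomorph.continuous.continuousOn
  continuousOn_invFun := hs

/-- **The volume of `D` along a sheet is Lebesgue measure**: `∫⁻_{s(V)} G d vol = ∫⁻_V G ∘ s dλ`.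
[folklore] -/
theorem lintegral_image_section {V : Set (ι → ℂ)} (hV : IsOpen V) {s : (ι → ℂ) → D} (hs : ContinuousOn s V)
    (hsec : ∀ z ∈ V, D.proj (s z) = z) {G : D → ℝ≥0∞} (hG : AEMeasurable G D.vol) :
    ∫⁻ y in s '' V, G y ∂D.vol = ∫⁻ z in V, G (s z) ∂volume := by
  have h := setLIntegral_symm_image (e := sectionHomeomorph hV hs hsec) rfl hV.measurableSet Subset.rfl hG
  exact h

/-! ### Sections over balls -/

/-- **Sections over balls**: if `proj` is a covering map over `Ω ⊇ B(z₀, r)`, every point of the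
fibre over `z₀` lies on a continuous section of `proj` over `B(z₀, r)` (lifting criterion for the
simply connected ball). [folklore] -/
theorem exists_section_ball {Ω : Set (ι → ℂ)} (hcov : IsCoveringMapOn D.proj Ω) {z₀ : ι → ℂ} {r : ℝ}
    (hr : 0 < r) (hB : ball z₀ r ⊆ Ω) {t : D} (ht : D.proj t = z₀) :
    ∃ s : (ι → ℂ) → D, ContinuousOn s (ball z₀ r) ∧ (∀ z ∈ ball z₀ r, D.proj (s z) = z) ∧ s z₀ = t := by
  haveI : ContractibleSpace (ball z₀ r) := (convex_ball z₀ r).contractibleSpace ⟨z₀, mem_ball_self hr⟩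
  haveI : LocallyPathConnectedSpace (ball z₀ r) := isOpen_ball.locallyPathConnectedSpace
  set incl : C(ball z₀ r, ι → ℂ) := ⟨Subtype.val, continuous_subtype_val⟩ with hincl
  obtain ⟨F, ⟨hF0, hFlift⟩, -⟩ := hcov.existsUnique_continuousMap_lifts incl (a₀ := ⟨z₀, mem_ball_self hr⟩)
    (e₀ := t) (by simpa [hincl] using ht) (fun a ↦ hB a.2)
  classical
  refine ⟨fun z ↦ if hz : z ∈ ball z₀ r then F ⟨z, hz⟩ else t, ?_, fun z hz ↦ ?_, ?_⟩
  · rw [continuousOn_iff_continuous_restrict]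
    convert F.continuous using 1
    funext z
    simp only [Set.restrict_apply, dif_pos z.2]
  · simp only [dif_pos hz]
    exact congr_fun hFlift ⟨z, hz⟩
  · simp only [dif_pos (mem_ball_self hr), hF0]

/-! ### The scaled mean-value inequality on `ℂ^ι` -/

/-- **Scaled mean-value inequality**: `|H(z₀)| ≤ C r^{-2n} ∫_{B̄(z₀,r)} |H|` for `H` holomorphic near
`B̄(z₀, r)`, with `C` depending only on `n = |ι|`. [cite: HormanderSCV1973, Thm 2.2.3 (Cauchy / mean value)] -/
theorem norm_le_mul_integral_closedBall :
    ∃ C : ℝ, 0 < C ∧ ∀ (H : (ι → ℂ) → ℂ) (V : Set (ι → ℂ)), IsOpen V → DifferentiableOn ℂ H V →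
      ∀ (z₀ : ι → ℂ) (r : ℝ), 0 < r → closedBall z₀ r ⊆ V →
        ‖H z₀‖ ≤ C * (r ^ (2 * Fintype.card ι))⁻¹ * ∫ w in closedBall z₀ r, ‖H w‖ := by
  classical
  obtain ⟨C, hC, hMV⟩ := WeylSCV.exists_meanValue_const (ι := ι) one_pos
  refine ⟨C, hC, fun H V hV hH z₀ r hr hsub ↦ ?_⟩
  set A : (ι → ℂ) → (ι → ℂ) := fun u ↦ z₀ + r • u with hA
  have hAc : Continuous A := by fun_prop
  have hAd : Differentiable ℂ A := fun u ↦ (differentiableAt_const z₀).add ((differentiableAt_id).const_smul r)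
  have hV' : IsOpen (A ⁻¹' V) := hV.preimage hAc
  have hf : DifferentiableOn ℂ (H ∘ A) (A ⁻¹' V) := hH.comp hAd.differentiableOn (mapsTo_preimage A V)
  have hsub' : closedBall (0 : ι → ℂ) 1 ⊆ A ⁻¹' V := fun u hu ↦ hsub (by
    rw [mem_closedBall, dist_zero_right] at hu
    rw [mem_closedBall, hA, dist_eq_norm, add_sub_cancel_left, norm_smul, Real.norm_of_nonneg hr.le]
    nlinarith)
  have h1 := hMV (H ∘ A) (A ⁻¹' V) hV' hf 0 hsub'
  have hf0 : (H ∘ A) 0 = H z₀ := by simp [hA]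
  -- change of variables `w = z₀ + r u`
  have hcv : ∫ u in closedBall (0 : ι → ℂ) 1, ‖(H ∘ A) u‖ = (r ^ (2 * Fintype.card ι))⁻¹ * ∫ w in closedBall z₀ r, ‖H w‖ := by
    have e1 := Measure.setIntegral_comp_smul_of_pos volume (fun w ↦ ‖H (z₀ + w)‖) (closedBall (0 : ι → ℂ) 1) hr
    have hfr : Module.finrank ℝ (ι → ℂ) = 2 * Fintype.card ι := by
      rw [Module.finrank_pi_fintype]; simp [Complex.finrank_real_complex, mul_comm]
    rw [smul_unitClosedBall_of_nonneg hr.le, hfr, smul_eq_mul] at e1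
    have e2 : ∫ w in closedBall (0 : ι → ℂ) r, ‖H (z₀ + w)‖ = ∫ w in closedBall z₀ r, ‖H w‖ := by
      rw [← integral_indicator measurableSet_closedBall, ← integral_indicator measurableSet_closedBall]
      have : (closedBall (0 : ι → ℂ) r).indicator (fun w ↦ ‖H (z₀ + w)‖) =
          fun w ↦ (closedBall z₀ r).indicator (fun w ↦ ‖H w‖) (z₀ + w) := by
        funext w
        simp only [indicator, mem_closedBall, dist_eq_norm, add_sub_cancel_left, sub_zero]
      rw [this, integral_add_left_eq_self]
    rw [← e2, ← e1]
    rfl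
  rw [← hf0]
  calc ‖(H ∘ A) 0‖ ≤ C * ∫ u in closedBall (0 : ι → ℂ) 1, ‖(H ∘ A) u‖ := h1
    _ = C * (r ^ (2 * Fintype.card ι))⁻¹ * ∫ w in closedBall z₀ r, ‖H w‖ := by rw [hcv, mul_assoc]

/-! ### Growth from the `L²` bound -/

omit [Fintype ι] in
/-- `a ≤ a² e^{-g} + e^{g}` for `a ≥ 0`. [folklore] -/
theorem le_sq_mul_exp_neg_add_exp {a : ℝ} (ha : 0 ≤ a) (g : ℝ) : a ≤ a ^ 2 * Real.exp (-g) + Real.exp g := by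
  have hkey : a ^ 2 * Real.exp (-g) + Real.exp g - a = Real.exp (-g) * ((a - Real.exp g) ^ 2 + a * Real.exp g) := by
    have : Real.exp (-g) * Real.exp g = 1 := by rw [← Real.exp_add]; simp
    linear_combination (a - Real.exp g) * this
  nlinarith [Real.exp_pos (-g), Real.exp_pos g, sq_nonneg (a - Real.exp g), mul_nonneg ha (Real.exp_pos g).le,
    mul_nonneg (Real.exp_pos (-g)).le (add_nonneg (sq_nonneg (a - Real.exp g)) (mul_nonneg ha (Real.exp_pos g).le))]

/-- **Growth of flat-holomorphic `L²` functions on the sheets over `Ω`.** Let `proj` be a covering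
map over `Ω`, `h` flat-holomorphic with `h ∈ L²(D, e^{-g∘proj} d vol)` (`g` continuous). There is
`C > 0` (depending only on `n = |ι|`) such that for every `t ∈ D` and `0 < r ≤ 1` with
`B(proj t, 2r) ⊆ Ω`, and every bound `e^{g} ≤ B` on `B̄(proj t, r)`,
`|h(t)| ≤ C r^{-2n} (‖h‖²_{L²(e^{-g∘proj})} + B)` (mean value on the sheet through `t` and
`|H| ≤ |H|² e^{-g} + e^{g}`). [cite: HormanderSCV1973, Thm 4.4.4 (polynomial growth of the interpolating function)] -/
theorem IsFlatHolomorphic.exists_norm_le_of_memLp {Ω : Set (ι → ℂ)} (hcov : IsCoveringMapOn D.proj Ω) :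
    ∃ C : ℝ, 0 < C ∧ ∀ {h : D → ℂ}, IsFlatHolomorphic D h → ∀ {g : (ι → ℂ) → ℝ}, Continuous g →
      MemLp h 2 (D.volW (g ∘ D.proj)) → ∀ (t : D) (r : ℝ), 0 < r → r ≤ 1 → ball (D.proj t) (2 * r) ⊆ Ω →
        ∀ B : ℝ, (∀ w ∈ closedBall (D.proj t) r, Real.exp (g w) ≤ B) →
          ‖h t‖ ≤ C * (r ^ (2 * Fintype.card ι))⁻¹ *
            ((eLpNorm h 2 (D.volW (g ∘ D.proj))).toReal ^ 2 + B) := by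
  obtain ⟨C₀, hC₀, hMV⟩ := norm_le_mul_integral_closedBall (ι := ι)
  set v₁ : ℝ := (volume (closedBall (0 : ι → ℂ) 1)).toReal with hv₁
  have hv₁0 : 0 ≤ v₁ := ENNReal.toReal_nonneg
  refine ⟨C₀ * max 1 v₁, mul_pos hC₀ (lt_max_of_lt_left one_pos), fun {h} hh {g} hg hmem t r hr hr1 hB B hgB ↦ ?_⟩
  set z₀ := D.proj t with hz₀
  -- the sheet through `t` over `B(z₀, 2r)`
  obtain ⟨s, hsc, hsec, hst⟩ := exists_section_ball hcov (by linarith) hB rfl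
  set V := ball z₀ (2 * r) with hV
  have hVo : IsOpen V := isOpen_ball
  have hHd : DifferentiableOn ℂ (h ∘ s) V := hh.differentiableOn_comp_section hVo hsc hsec
  have hcb : closedBall z₀ r ⊆ V := closedBall_subset_ball (by linarith)
  have h1 := hMV (h ∘ s) V hVo hHd z₀ r hr hcb
  rw [show (h ∘ s) z₀ = h t by simp [hst]] at h1
  -- `∫_{B̄} |h ∘ s| ≤ ‖h‖² + B v₁`
  have hHc : ContinuousOn (h ∘ s) V := hHd.continuousOn
  have hμfin : volume (closedBall z₀ r) < ⊤ := measure_closedBall_lt_top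
  have hint1 : IntegrableOn (fun w ↦ ‖(h ∘ s) w‖) (closedBall z₀ r) volume :=
    (hHc.norm.mono hcb).integrableOn_compact (isCompact_closedBall z₀ r)
  have hint2 : IntegrableOn (fun w ↦ ‖(h ∘ s) w‖ ^ 2 * Real.exp (-g w) + Real.exp (g w)) (closedBall z₀ r) volume :=
    ((((hHc.norm.pow 2).mul ((Real.continuous_exp.comp hg.neg).continuousOn)).add
      (Real.continuous_exp.comp hg).continuousOn).mono hcb).integrableOn_compact (isCompact_closedBall z₀ r)
  have hle1 : ∫ w in closedBall z₀ r, ‖(h ∘ s) w‖ ≤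
      ∫ w in closedBall z₀ r, (‖(h ∘ s) w‖ ^ 2 * Real.exp (-g w) + Real.exp (g w)) :=
    setIntegral_mono_on hint1 hint2 measurableSet_closedBall fun w _ ↦ le_sq_mul_exp_neg_add_exp (norm_nonneg _) _
  have hint3 : IntegrableOn (fun w ↦ ‖(h ∘ s) w‖ ^ 2 * Real.exp (-g w)) (closedBall z₀ r) volume :=
    (((hHc.norm.pow 2).mul ((Real.continuous_exp.comp hg.neg).continuousOn)).mono hcb).integrableOn_compact
      (isCompact_closedBall z₀ r)
  have hint4 : IntegrableOn (fun w ↦ Real.exp (g w)) (closedBall z₀ r) volume :=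
    ((Real.continuous_exp.comp hg).continuousOn.mono hcb).integrableOn_compact (isCompact_closedBall z₀ r)
  rw [integral_add hint3 hint4] at hle1
  -- the weighted term is bounded by the global `L²` norm
  have hL2 : ∫ w in closedBall z₀ r, ‖(h ∘ s) w‖ ^ 2 * Real.exp (-g w) ≤ (eLpNorm h 2 (D.volW (g ∘ D.proj))).toReal ^ 2 := by
    have hmeas : AEStronglyMeasurable h D.vol := aestronglyMeasurable_of_memLp_volW (hg.comp D.isLocalHomeomorph.continuous) hmem
    have hG : AEMeasurable (fun y ↦ ENNReal.ofReal (‖h y‖ ^ 2 * Real.exp (-(g ∘ D.proj) y))) D.vol :=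
      ENNReal.measurable_ofReal.comp_aemeasurable ((hmeas.norm.aemeasurable.pow_const 2).mul
        (Real.measurable_exp.comp (hg.comp D.isLocalHomeomorph.continuous).measurable.neg).aemeasurable)
    have e1 : ∫ w in closedBall z₀ r, ‖(h ∘ s) w‖ ^ 2 * Real.exp (-g w) =
        (∫⁻ w in closedBall z₀ r, ENNReal.ofReal (‖(h ∘ s) w‖ ^ 2 * Real.exp (-g w))).toReal :=
      integral_eq_lintegral_of_nonneg_ae (ae_of_all _ fun w ↦ by positivity) hint3.aestronglyMeasurable
    have e2 : ∫⁻ w in closedBall z₀ r, ENNReal.ofReal (‖(h ∘ s) w‖ ^ 2 * Real.exp (-g w)) ≤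
        ∫⁻ y, ENNReal.ofReal (‖h y‖ ^ 2 * Real.exp (-(g ∘ D.proj) y)) ∂D.vol := by
      calc ∫⁻ w in closedBall z₀ r, ENNReal.ofReal (‖(h ∘ s) w‖ ^ 2 * Real.exp (-g w))
          ≤ ∫⁻ w in V, ENNReal.ofReal (‖(h ∘ s) w‖ ^ 2 * Real.exp (-g w)) := lintegral_mono_set hcb
        _ = ∫⁻ w in V, ENNReal.ofReal (‖h (s w)‖ ^ 2 * Real.exp (-(g ∘ D.proj) (s w))) :=
            setLIntegral_congr_fun hVo.measurableSet fun w hw ↦ by simp only [comp_apply, hsec w hw]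
        _ = ∫⁻ y in s '' V, ENNReal.ofReal (‖h y‖ ^ 2 * Real.exp (-(g ∘ D.proj) y)) ∂D.vol :=
            (lintegral_image_section hVo hsc hsec hG).symm
        _ ≤ ∫⁻ y, ENNReal.ofReal (‖h y‖ ^ 2 * Real.exp (-(g ∘ D.proj) y)) ∂D.vol := lintegral_mono' Measure.restrict_le_self le_rfl
    have e3 : ∫⁻ y, ENNReal.ofReal (‖h y‖ ^ 2 * Real.exp (-(g ∘ D.proj) y)) ∂D.vol = eLpNorm h 2 (D.volW (g ∘ D.proj)) ^ 2 := by
      rw [lintegral_ofReal_norm_sq_mul_exp (hg.comp D.isLocalHomeomorph.continuous), FluidPDE.eLpNorm_two_eq_rpow,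
        ← ENNReal.rpow_natCast, ← ENNReal.rpow_mul]
      norm_num
    rw [e1, ← ENNReal.toReal_pow]
    exact ENNReal.toReal_mono (ENNReal.pow_ne_top hmem.eLpNorm_ne_top) (e2.trans_eq e3)
  -- the unweighted term: `∫_{B̄} e^{g} ≤ B v₁`
  have hexpB : ∫ w in closedBall z₀ r, Real.exp (g w) ≤ B * v₁ := by
    have hB0 : 0 ≤ B := (Real.exp_pos _).le.trans (hgB z₀ (mem_closedBall_self hr.le))
    calc ∫ w in closedBall z₀ r, Real.exp (g w) ≤ ∫ _ in closedBall z₀ r, B :=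
          setIntegral_mono_on hint4 (integrableOn_const hμfin.ne) measurableSet_closedBall fun w hw ↦ hgB w hw
      _ = B * (volume (closedBall z₀ r)).toReal := by rw [setIntegral_const, smul_eq_mul, mul_comm]; rfl
      _ ≤ B * v₁ := by
          refine mul_le_mul_of_nonneg_left ?_ hB0
          rw [hv₁, Measure.addHaar_closedBall_center volume z₀ r]
          exact ENNReal.toReal_mono measure_closedBall_lt_top.ne (measure_mono (closedBall_subset_closedBall hr1))
  -- assemble
  have hr0 : 0 < (r ^ (2 * Fintype.card ι))⁻¹ := by positivity
  have hN0 : 0 ≤ (eLpNorm h 2 (D.volW (g ∘ D.proj))).toReal ^ 2 := sq_nonneg _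
  have hB0 : 0 ≤ B := (Real.exp_pos _).le.trans (hgB z₀ (mem_closedBall_self hr.le))
  calc ‖h t‖ ≤ C₀ * (r ^ (2 * Fintype.card ι))⁻¹ * ∫ w in closedBall z₀ r, ‖(h ∘ s) w‖ := h1
    _ ≤ C₀ * (r ^ (2 * Fintype.card ι))⁻¹ * ((eLpNorm h 2 (D.volW (g ∘ D.proj))).toReal ^ 2 + B * v₁) := by
        gcongr
        exact hle1.trans (add_le_add hL2 hexpB)
    _ ≤ C₀ * max 1 v₁ * (r ^ (2 * Fintype.card ι))⁻¹ * ((eLpNorm h 2 (D.volW (g ∘ D.proj))).toReal ^ 2 + B) := by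
        have h2 : (eLpNorm h 2 (D.volW (g ∘ D.proj))).toReal ^ 2 + B * v₁ ≤
            max 1 v₁ * ((eLpNorm h 2 (D.volW (g ∘ D.proj))).toReal ^ 2 + B) := by
          nlinarith [le_max_left 1 v₁, le_max_right 1 v₁, mul_nonneg hB0 hv₁0]
        calc C₀ * (r ^ (2 * Fintype.card ι))⁻¹ * ((eLpNorm h 2 (D.volW (g ∘ D.proj))).toReal ^ 2 + B * v₁)
            ≤ C₀ * (r ^ (2 * Fintype.card ι))⁻¹ * (max 1 v₁ * ((eLpNorm h 2 (D.volW (g ∘ D.proj))).toReal ^ 2 + B)) :=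
              mul_le_mul_of_nonneg_left h2 (by positivity)
          _ = _ := by ring

end RiemannDomain

end Literature.Analysis.Complex
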